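import Summits.AtomisticToContinuum.HydrodynamicLimit.Theorems.InformationPercolationEngineCollisionRateReductionProb
import Summits.AtomisticToContinuum.HydrodynamicLimit.Theorems.InformationPercolationEngineCollisionRateCoreNecessity
import Summits.AtomisticToContinuum.HydrodynamicLimit.Theorems.InformationPercolationEngineCollisionRateMarginalEnvelopeOfLanfordEnvelope
import Summits.AtomisticToContinuum.HydrodynamicLimit.Theorems.InformationPercolationEngineCollisionRateEvenTubeStatL1Rung0
import HarnessLib

/-!
# `InformationPercolationEngine.CollisionRate` (stmt-AtomisticToContinuum-13481) CHARACTERISED: under the marginal envelope (A) the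
# crux is EQUIVALENT to the in-probability smallness T34p of the time-integrated even tube statistic

Helper file (`--supports stmt-AtomisticToContinuum-13481`) of the crux line `Sketch` (lead c8 = prover-line-stmt-AtomisticToContinuum-13481-c8-0,
skeleton `Cruxes/CollisionRate/Lines/Sketch.lean` v26).  It assembles the two landed directions — RED′
`stub_evenStatOne_of_evenTubeTimeStatProb` (`…CollisionRateReductionProb.lean`: `(A) → T34p → crux`) and NEC
`stub_evenTubeTimeStatProb_of_evenStatOne` (`…CollisionRateCoreNecessity.lean`: `(A) → crux → T34p`) — into the characterisation

  `stub_collisionRateCoreEquivalence : (A) → (CollisionRate ↔ T34p)`,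

reads it from the EXISTING a-priori crux item `BGEndpointRigidity.LanfordEnvelopeR` (stmt-AtomisticToContinuum-13677) through the landed
bridge `stub_marginalEnvelopeLG_of_lanfordEnvelopeR` (`…CollisionRateMarginalEnvelopeOfLanfordEnvelope.lean`), and records the two sanity
facts about T34p: it is implied by the `L¹` form T34 of the line's earlier skeletons (`evenTubeTimeStatProb_of_evenTubeStatL1`, Markov along
the flow, `measure_lt_abs_setIntegral_flow_le_of_l1`) and it HOLDS at global equilibrium (`evenTubeTimeStatProb_const`, from the landed
rung-0 theorem `stub_evenTubeStatL1Rung0`, `…CollisionRateEvenTubeStatL1Rung0.lean`).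

The statements (verbatim the skeleton's shapes; no new definitions):
* (A) MARGINAL ENVELOPE OF THE EVOLVED LAW — pair and triple labelled marginals of `LG_t = (Φ_t)_# LG` dominated on `[0, τ]`, for
  `N ≥ N₀`, by `C × (Haar ⊗ N(u, θ))^{⊗k}` (`lintegral` form); Lanford-type a-priori bound at fixed reduced density, the `k ∈ {2,3}`
  instance of `LanfordEnvelopeR`; OPEN at `t > 0`.
* T34p — for local Gibbs data, `σ < σ₀`, every flow family, horizon `τ > 0`, localiser `χ`, cutoff `g` vanishing on `[η₀, ∞)` and
  accuracies `η, δ`: for `r < r₀`, `L ≥ L₀`, `κ < κ₀`, `N ≥ N₀`, with `LG`-probability `≥ 1 − δ`,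
  `|∫₀^τ (A_t − σ³ e_t)(Φ_t z) dt| ≤ η`, where `A_t` is Boltzmann's collision cylinder read on ONE configuration at flight-time
  resolution `κ ε_N` (`tubeStat`: `((N+1)κ)⁻¹ ×` the `χ g(σ³ρ_r) Ξ₁ᴸ`-marked number of ordered pairs apart, approaching and due to
  touch within `κ ε_N` under free pair flight) and `e_t = ∫ χ g(σ³ρ_r) Y(σ³ρ_r) B_r(Ξ₁ᴸ) dx` is Enskog's prediction from the SAME
  configuration's `r`-ball fields (`enskogRate`, contact value `Y = (3/2π) f_ex′`).

So, modulo the a-priori item 13677, the crux `CollisionRate` (the Enskog collision-frequency law for the deterministic hard-sphere flow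
at fixed `σ`, `K_N[χ g(σ³ρ_r)] − σ³∫₀^τ∫ χ g Y B¹_r → 0` in probability) IS the kinetic statement T34p — no more and no less: the
line `Sketch` cannot be reduced further, and a planner who promotes T34p re-lines the crux faithfully.  Not here: any claim on (A) or on
T34p at `t > 0` (the Boltzmann–Enskog rate hypothesis; OPEN).

References: H. van Beijeren, M. H. Ernst, Physica 68 (1973) 437–456; P. Résibois, J. Stat. Phys. 19 (1978) 593–609; H. Spohn,
*Large Scale Dynamics of Interacting Particles* (1991), Part I §2.4, §3; C. Cercignani, R. Illner, M. Pulvirenti, *The Mathematical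
Theory of Dilute Gases* (1994), §2.2, §4.3; O. E. Lanford, *Time evolution of large classical systems* (1975).
-/

open scoped BigOperators Topology Classical MeasureTheory ProbabilityTheory InnerProductSpace ENNReal
open Filter Set Function MeasureTheory
open Literature.Analysis.FluidPDE Literature.MathematicalPhysics.KineticTheory

namespace Summit.AtomisticToContinuum.HydrodynamicLimit.Theorems.CollisionRate

open Summit.AtomisticToContinuum.HydrodynamicLimit.Theses.InformationPercolationEngine

noncomputable section

/-- **THE CHARACTERISATION `(A) → (CollisionRate ↔ T34p)`.**  Under the marginal envelope (A) of the evolved local Gibbs law the crux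
`InformationPercolationEngine.CollisionRate` is EQUIVALENT to T34p, the in-`LG`-probability smallness of the time-integrated even tube
statistic `evenTubeTimeStat σ N (Φ N) τ χ g Ξ₁ᴸ r κ` (`N → ∞` after `κ → 0` after `L → ∞` at fixed small `r`, then `r → 0`).
`→`: NEC `evenTubeTimeStatProb_of_marginalEnvelope_of_collisionRate`; `←`: RED′ `collisionRate_of_marginalEnvelope_of_evenTubeTimeStatProb`.
Name and header are those of the registered stub EQV of the skeleton v26. [folklore] -/
theorem stub_collisionRateCoreEquivalence :
    (    ∀ (a₀ θ₀ : T3 → ℝ) (u₀ : T3 → V3), Continuous a₀ → Continuous θ₀ → Continuous u₀ →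
      (∀ x, 0 < a₀ x) → (∀ x, 0 < θ₀ x) → ∃ σ₀ : ℝ, 0 < σ₀ ∧ ∀ σ : ℝ, 0 < σ → σ < σ₀ →
      ∀ Φ : (N : ℕ) → HardSphereFlow (Torus.geometry (Fin 3)) (hsDiameter σ N) (N + 1),
      ∀ τ : ℝ, 0 < τ → ∃ C : ℝ, 0 ≤ C ∧ ∃ u : V3, ∃ θ : ℝ, 0 < θ ∧ ∃ N₀ : ℕ, ∀ N : ℕ, N₀ ≤ N →
      ∀ t ∈ Set.Icc (0 : ℝ) τ,
        (∀ i j : Fin (N + 1), i ≠ j → ∀ f : (T3 × V3) × (T3 × V3) → ℝ≥0∞, Measurable f →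
          ∫⁻ z, f ((Φ N).flow t z i, (Φ N).flow t z j) ∂(localGibbsLaw σ a₀ u₀ θ₀ N (Φ N)) ≤
            ENNReal.ofReal C * ∫⁻ q, f q ∂(((volume : Measure T3).prod (gaussMeasure u θ)).prod
              ((volume : Measure T3).prod (gaussMeasure u θ)))) ∧
        (∀ i j k : Fin (N + 1), i ≠ j → i ≠ k → j ≠ k → ∀ f : (T3 × V3) × (T3 × V3) × (T3 × V3) → ℝ≥0∞, Measurable f →
          ∫⁻ z, f ((Φ N).flow t z i, (Φ N).flow t z j, (Φ N).flow t z k) ∂(localGibbsLaw σ a₀ u₀ θ₀ N (Φ N)) ≤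
            ENNReal.ofReal C * ∫⁻ q, f q ∂(((volume : Measure T3).prod (gaussMeasure u θ)).prod
              (((volume : Measure T3).prod (gaussMeasure u θ)).prod ((volume : Measure T3).prod (gaussMeasure u θ)))))) →
    (CollisionRate ↔
        ∃ η₀ : ℝ, 0 < η₀ ∧ ∀ (a₀ θ₀ : T3 → ℝ) (u₀ : T3 → V3), Continuous a₀ → Continuous θ₀ → Continuous u₀ →
      (∀ x, 0 < a₀ x) → (∀ x, 0 < θ₀ x) → ∃ σ₀ : ℝ, 0 < σ₀ ∧ ∀ σ : ℝ, 0 < σ → σ < σ₀ →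
      ∀ Φ : (N : ℕ) → HardSphereFlow (Torus.geometry (Fin 3)) (hsDiameter σ N) (N + 1),
      ∀ τ : ℝ, 0 < τ → ∀ χ : ℝ × T3 → ℝ, Continuous χ → ∀ g : ℝ → ℝ, Continuous g →
      (∀ x, η₀ ≤ x → g x = 0) →
      ∀ η δ : ℝ, 0 < η → 0 < δ → ∃ r₀ : ℝ, 0 < r₀ ∧ ∀ r : ℝ, 0 < r → r < r₀ →
      ∃ L₀ : ℝ, ∀ L : ℝ, L₀ ≤ L → ∃ κ₀ : ℝ, 0 < κ₀ ∧ ∀ κ : ℝ, 0 < κ → κ < κ₀ → ∃ N₀ : ℕ, ∀ N : ℕ, N₀ ≤ N →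
        localGibbsLaw σ a₀ u₀ θ₀ N (Φ N)
          {z | η < |evenTubeTimeStat σ N (Φ N) τ χ g (fun q : V3 × V3 × V3 => speedCutoff L ‖q.2.2 - q.2.1‖) r κ z|}
          ≤ ENNReal.ofReal δ) :=
  fun hA => ⟨evenTubeTimeStatProb_of_marginalEnvelope_of_collisionRate hA,
    collisionRate_of_marginalEnvelope_of_evenTubeTimeStatProb hA⟩

/-- **The characterisation from the EXISTING a-priori item** `BGEndpointRigidity.LanfordEnvelopeR` (stmt-AtomisticToContinuum-13677):
`LanfordEnvelopeR → (CollisionRate ↔ T34p)`, through the landed bridge `stub_marginalEnvelopeLG_of_lanfordEnvelopeR`. [folklore] -/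
theorem collisionRate_iff_evenTubeTimeStatProb_of_lanfordEnvelopeR
    (hE : Summit.AtomisticToContinuum.HydrodynamicLimit.Theses.BGEndpointRigidity.LanfordEnvelopeR) :
    CollisionRate ↔
        ∃ η₀ : ℝ, 0 < η₀ ∧ ∀ (a₀ θ₀ : T3 → ℝ) (u₀ : T3 → V3), Continuous a₀ → Continuous θ₀ → Continuous u₀ →
      (∀ x, 0 < a₀ x) → (∀ x, 0 < θ₀ x) → ∃ σ₀ : ℝ, 0 < σ₀ ∧ ∀ σ : ℝ, 0 < σ → σ < σ₀ →
      ∀ Φ : (N : ℕ) → HardSphereFlow (Torus.geometry (Fin 3)) (hsDiameter σ N) (N + 1),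
      ∀ τ : ℝ, 0 < τ → ∀ χ : ℝ × T3 → ℝ, Continuous χ → ∀ g : ℝ → ℝ, Continuous g →
      (∀ x, η₀ ≤ x → g x = 0) →
      ∀ η δ : ℝ, 0 < η → 0 < δ → ∃ r₀ : ℝ, 0 < r₀ ∧ ∀ r : ℝ, 0 < r → r < r₀ →
      ∃ L₀ : ℝ, ∀ L : ℝ, L₀ ≤ L → ∃ κ₀ : ℝ, 0 < κ₀ ∧ ∀ κ : ℝ, 0 < κ → κ < κ₀ → ∃ N₀ : ℕ, ∀ N : ℕ, N₀ ≤ N →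
        localGibbsLaw σ a₀ u₀ θ₀ N (Φ N)
          {z | η < |evenTubeTimeStat σ N (Φ N) τ χ g (fun q : V3 × V3 × V3 => speedCutoff L ‖q.2.2 - q.2.1‖) r κ z|}
          ≤ ENNReal.ofReal δ :=
  stub_collisionRateCoreEquivalence (stub_marginalEnvelopeLG_of_lanfordEnvelopeR hE)

/-- **`CollisionRate ⇐ LanfordEnvelopeR ∧ T34p`** — the net transfer of the line `Sketch` after v26: the crux from the existing
a-priori item stmt-13677 and the kinetic core T34p. [folklore] -/
theorem collisionRate_of_lanfordEnvelopeR_of_evenTubeTimeStatProb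
    (hE : Summit.AtomisticToContinuum.HydrodynamicLimit.Theses.BGEndpointRigidity.LanfordEnvelopeR)
    (hT34p :     ∃ η₀ : ℝ, 0 < η₀ ∧ ∀ (a₀ θ₀ : T3 → ℝ) (u₀ : T3 → V3), Continuous a₀ → Continuous θ₀ → Continuous u₀ →
      (∀ x, 0 < a₀ x) → (∀ x, 0 < θ₀ x) → ∃ σ₀ : ℝ, 0 < σ₀ ∧ ∀ σ : ℝ, 0 < σ → σ < σ₀ →
      ∀ Φ : (N : ℕ) → HardSphereFlow (Torus.geometry (Fin 3)) (hsDiameter σ N) (N + 1),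
      ∀ τ : ℝ, 0 < τ → ∀ χ : ℝ × T3 → ℝ, Continuous χ → ∀ g : ℝ → ℝ, Continuous g →
      (∀ x, η₀ ≤ x → g x = 0) →
      ∀ η δ : ℝ, 0 < η → 0 < δ → ∃ r₀ : ℝ, 0 < r₀ ∧ ∀ r : ℝ, 0 < r → r < r₀ →
      ∃ L₀ : ℝ, ∀ L : ℝ, L₀ ≤ L → ∃ κ₀ : ℝ, 0 < κ₀ ∧ ∀ κ : ℝ, 0 < κ → κ < κ₀ → ∃ N₀ : ℕ, ∀ N : ℕ, N₀ ≤ N →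
        localGibbsLaw σ a₀ u₀ θ₀ N (Φ N)
          {z | η < |evenTubeTimeStat σ N (Φ N) τ χ g (fun q : V3 × V3 × V3 => speedCutoff L ‖q.2.2 - q.2.1‖) r κ z|}
          ≤ ENNReal.ofReal δ) :
    CollisionRate :=
  (collisionRate_iff_evenTubeTimeStatProb_of_lanfordEnvelopeR hE).2 hT34p

/-- **T34 ⇒ T34p.**  The `L¹` form of the kinetic core used by the skeletons v21–v25 — `∫₀^τ E_LG|W_t ∘ Φ_t| dt ≤ η` for the even
tube functional `W_t = evenTubeStat` at `Ξ₁ᴸ` — implies T34p: Markov along the flow (`measure_lt_abs_setIntegral_flow_le_of_l1`) with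
the mark-1 regularity `evenTubeStatRegular_one` and `isProbabilityMeasure_localGibbsLaw`; thresholds `η₀ := min η₃ η₆`,
`σ₀ := min σ₃ (1/2)`, `L₀ := 1`, `L¹` budget `η δ`. [folklore] -/
theorem evenTubeTimeStatProb_of_evenTubeStatL1
    (h :     ∃ η₀ : ℝ, 0 < η₀ ∧ ∀ (a₀ θ₀ : T3 → ℝ) (u₀ : T3 → V3), Continuous a₀ → Continuous θ₀ → Continuous u₀ →
      (∀ x, 0 < a₀ x) → (∀ x, 0 < θ₀ x) → ∃ σ₀ : ℝ, 0 < σ₀ ∧ ∀ σ : ℝ, 0 < σ → σ < σ₀ →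
      ∀ Φ : (N : ℕ) → HardSphereFlow (Torus.geometry (Fin 3)) (hsDiameter σ N) (N + 1),
      ∀ τ : ℝ, 0 < τ → ∀ χ : ℝ × T3 → ℝ, Continuous χ → ∀ g : ℝ → ℝ, Continuous g →
      (∀ x, η₀ ≤ x → g x = 0) →
      ∀ η : ℝ, 0 < η → ∃ r₀ : ℝ, 0 < r₀ ∧ ∀ r : ℝ, 0 < r → r < r₀ →
      ∀ L : ℝ, 1 ≤ L → ∃ κ₀ : ℝ, 0 < κ₀ ∧ ∀ κ : ℝ, 0 < κ → κ < κ₀ → ∃ N₀ : ℕ, ∀ N : ℕ, N₀ ≤ N →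
        ∫ t in Set.Icc (0 : ℝ) τ,
            ∫ z, |evenTubeStat σ N χ g (fun q : V3 × V3 × V3 => speedCutoff L ‖q.2.2 - q.2.1‖) r κ t ((Φ N).flow t z)|
              ∂(localGibbsLaw σ a₀ u₀ θ₀ N (Φ N)) ≤ η) :
        ∃ η₀ : ℝ, 0 < η₀ ∧ ∀ (a₀ θ₀ : T3 → ℝ) (u₀ : T3 → V3), Continuous a₀ → Continuous θ₀ → Continuous u₀ →
      (∀ x, 0 < a₀ x) → (∀ x, 0 < θ₀ x) → ∃ σ₀ : ℝ, 0 < σ₀ ∧ ∀ σ : ℝ, 0 < σ → σ < σ₀ →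
      ∀ Φ : (N : ℕ) → HardSphereFlow (Torus.geometry (Fin 3)) (hsDiameter σ N) (N + 1),
      ∀ τ : ℝ, 0 < τ → ∀ χ : ℝ × T3 → ℝ, Continuous χ → ∀ g : ℝ → ℝ, Continuous g →
      (∀ x, η₀ ≤ x → g x = 0) →
      ∀ η δ : ℝ, 0 < η → 0 < δ → ∃ r₀ : ℝ, 0 < r₀ ∧ ∀ r : ℝ, 0 < r → r < r₀ →
      ∃ L₀ : ℝ, ∀ L : ℝ, L₀ ≤ L → ∃ κ₀ : ℝ, 0 < κ₀ ∧ ∀ κ : ℝ, 0 < κ → κ < κ₀ → ∃ N₀ : ℕ, ∀ N : ℕ, N₀ ≤ N →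
        localGibbsLaw σ a₀ u₀ θ₀ N (Φ N)
          {z | η < |evenTubeTimeStat σ N (Φ N) τ χ g (fun q : V3 × V3 × V3 => speedCutoff L ‖q.2.2 - q.2.1‖) r κ z|}
          ≤ ENNReal.ofReal δ := by
  have hS6 := Summit.AtomisticToContinuum.HydrodynamicLimit.Theorems.CollisionRate.evenTubeStatRegular_one
  obtain ⟨η₃, hη₃, H3⟩ := h
  obtain ⟨η₆, hη₆, H6⟩ := hS6
  refine ⟨min η₃ η₆, lt_min hη₃ hη₆, ?_⟩
  intro a₀ θ₀ u₀ ha hθ hu ha0 hθ0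
  obtain ⟨σ₃, hσ₃, H3⟩ := H3 a₀ θ₀ u₀ ha hθ hu ha0 hθ0
  refine ⟨min σ₃ (1 / 2), lt_min hσ₃ (by norm_num), ?_⟩
  intro σ hσ hσlt Φ τ hτ χ hχ g hg hg0 η δ hη hδ
  have hσ3 : σ < σ₃ := lt_of_lt_of_le hσlt (min_le_left _ _)
  have hσhalf : σ ≤ 1 / 2 := (lt_of_lt_of_le hσlt (min_le_right _ _)).le
  have hg3 : ∀ x, η₃ ≤ x → g x = 0 := fun x hx => hg0 x ((min_le_left _ _).trans hx)
  have hg6 : ∀ x, η₆ ≤ x → g x = 0 := fun x hx => hg0 x ((min_le_right _ _).trans hx)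
  have hm : 0 < η * δ := mul_pos hη hδ
  obtain ⟨r₃, hr₃, H3⟩ := H3 σ hσ hσ3 Φ τ hτ χ hχ g hg hg3 (η * δ) hm
  refine ⟨r₃, hr₃, fun r hr hrlt => ⟨1, fun L hL => ?_⟩⟩
  have hLpos : (0 : ℝ) < L := one_pos.trans_le hL
  obtain ⟨κ₃, hκ₃, H3⟩ := H3 r hr hrlt L hL
  refine ⟨κ₃, hκ₃, fun κ hκ hκlt => ?_⟩
  obtain ⟨N₃, H3⟩ := H3 κ hκ hκlt
  refine ⟨N₃, fun N hN => ?_⟩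
  have E3 := H3 N hN
  obtain ⟨hmeas, B, hB⟩ := H6 σ N χ g L r κ τ hσ hχ hg hg6 hLpos hr hκ.le
  have hPN : IsProbabilityMeasure (localGibbsLaw σ a₀ u₀ θ₀ N (Φ N)) :=
    isProbabilityMeasure_localGibbsLaw ha hθ hu ha0 hθ0 hσhalf N (Φ N)
  have E5 := measure_lt_abs_setIntegral_flow_le_of_l1 σ a₀ θ₀ u₀ N (Φ N)
    (A := fun t z => evenTubeStat σ N χ g (fun q : V3 × V3 × V3 => speedCutoff L ‖q.2.2 - q.2.1‖) r κ t z)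
    hmeas hB hτ hη E3
  have hval : η * δ / η = δ := by field_simp
  rw [hval] at E5
  exact E5

/-- **T34p HOLDS AT GLOBAL EQUILIBRIUM** (constant profiles `(ā, ū, θ̄)`: the local Gibbs law is the flow-invariant canonical law):
the registered stub is correctly normalised — from the landed rung-0 `L¹` theorem `stub_evenTubeStatL1Rung0` by the same Markov step.
[folklore] -/
theorem evenTubeTimeStatProb_const :
        ∃ η₀ : ℝ, 0 < η₀ ∧ ∀ (ab θb : ℝ) (ub : V3), 0 < ab → 0 < θb → ∃ σ₀ : ℝ, 0 < σ₀ ∧ ∀ σ : ℝ, 0 < σ → σ < σ₀ →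
      ∀ Φ : (N : ℕ) → HardSphereFlow (Torus.geometry (Fin 3)) (hsDiameter σ N) (N + 1),
      ∀ τ : ℝ, 0 < τ → ∀ χ : ℝ × T3 → ℝ, Continuous χ → ∀ g : ℝ → ℝ, Continuous g →
      (∀ x, η₀ ≤ x → g x = 0) →
      ∀ η δ : ℝ, 0 < η → 0 < δ → ∃ r₀ : ℝ, 0 < r₀ ∧ ∀ r : ℝ, 0 < r → r < r₀ →
      ∃ L₀ : ℝ, ∀ L : ℝ, L₀ ≤ L → ∃ κ₀ : ℝ, 0 < κ₀ ∧ ∀ κ : ℝ, 0 < κ → κ < κ₀ → ∃ N₀ : ℕ, ∀ N : ℕ, N₀ ≤ N →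
        localGibbsLaw σ (fun _ => ab) (fun _ => ub) (fun _ => θb) N (Φ N)
          {z | η < |evenTubeTimeStat σ N (Φ N) τ χ g (fun q : V3 × V3 × V3 => speedCutoff L ‖q.2.2 - q.2.1‖) r κ z|}
          ≤ ENNReal.ofReal δ := by
  have hS6 := Summit.AtomisticToContinuum.HydrodynamicLimit.Theorems.CollisionRate.evenTubeStatRegular_one
  obtain ⟨η₃, hη₃, H3⟩ := stub_evenTubeStatL1Rung0
  obtain ⟨η₆, hη₆, H6⟩ := hS6
  refine ⟨min η₃ η₆, lt_min hη₃ hη₆, ?_⟩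
  intro ab θb ub hab hθb
  obtain ⟨σ₃, hσ₃, H3⟩ := H3 ab θb ub hab hθb
  refine ⟨min σ₃ (1 / 2), lt_min hσ₃ (by norm_num), ?_⟩
  intro σ hσ hσlt Φ τ hτ χ hχ g hg hg0 η δ hη hδ
  have hσ3 : σ < σ₃ := lt_of_lt_of_le hσlt (min_le_left _ _)
  have hσhalf : σ ≤ 1 / 2 := (lt_of_lt_of_le hσlt (min_le_right _ _)).le
  have hg3 : ∀ x, η₃ ≤ x → g x = 0 := fun x hx => hg0 x ((min_le_left _ _).trans hx)
  have hg6 : ∀ x, η₆ ≤ x → g x = 0 := fun x hx => hg0 x ((min_le_right _ _).trans hx)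
  have hm : 0 < η * δ := mul_pos hη hδ
  obtain ⟨r₃, hr₃, H3⟩ := H3 σ hσ hσ3 Φ τ hτ χ hχ g hg hg3 (η * δ) hm
  refine ⟨r₃, hr₃, fun r hr hrlt => ⟨1, fun L hL => ?_⟩⟩
  have hLpos : (0 : ℝ) < L := one_pos.trans_le hL
  obtain ⟨κ₃, hκ₃, H3⟩ := H3 r hr hrlt L hL
  refine ⟨κ₃, hκ₃, fun κ hκ hκlt => ?_⟩
  obtain ⟨N₃, H3⟩ := H3 κ hκ hκlt
  refine ⟨N₃, fun N hN => ?_⟩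
  have E3 := H3 N hN
  obtain ⟨hmeas, B, hB⟩ := H6 σ N χ g L r κ τ hσ hχ hg hg6 hLpos hr hκ.le
  have hPN : IsProbabilityMeasure (localGibbsLaw σ (fun _ => ab) (fun _ => ub) (fun _ => θb) N (Φ N)) :=
    isProbabilityMeasure_localGibbsLaw continuous_const continuous_const continuous_const (fun _ => hab) (fun _ => hθb)
      hσhalf N (Φ N)
  have E5 := measure_lt_abs_setIntegral_flow_le_of_l1 σ (fun _ => ab) (fun _ => θb) (fun _ => ub) N (Φ N)
    (A := fun t z => evenTubeStat σ N χ g (fun q : V3 × V3 × V3 => speedCutoff L ‖q.2.2 - q.2.1‖) r κ t z)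
    hmeas hB hτ hη E3
  have hval : η * δ / η = δ := by field_simp
  rw [hval] at E5
  exact E5

end

end Summit.AtomisticToContinuum.HydrodynamicLimit.Theorems.CollisionRate
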